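import Summits.AtomisticToContinuum.HydrodynamicLimit.Theorems.BoxDissipativeWeakStrongLocalGibbsFineScaleUniformTwoPt
import HarnessLib

/-!
# Shift-Lipschitz of the one-point expectation of the canonical hard-sphere gas with a slowly varying
# one-body law (s = 0 inhomogeneous rung of stub `stub_mesoVariance`, line `meso-chebyshev-window`,
# crux `AprioriBounds`, stmt-AtomisticToContinuum-14827) — file 1 of 2

Helper file (`--supports stmt-AtomisticToContinuum-14827`).  For `N + 1` hard spheres of diameter
`ε_N = hsDiameter σ N` on `𝕋³` with one-particle law `μ = β dy` (`DensityProfile P`) at small reduced density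
(`SmallDensity P σ`), write `E_{N+1-s}[χ(x₀)] = onePt P σ χ N s` (`HardSphereEulerLLN`).  GIVEN a level-Lipschitz
bound `δ` for the insertion ratios, `|q_N(k+1) − q_N(k)| ≤ δ` for `k + 1 ≤ N` (proved with `δ = O(λ/(N+1))` in
the companion file `…MesoRatioLipschitz`), we prove the SHIFT-LIPSCHITZ estimate in the sup norm

  `|E_{N+1-s}[χ] − E_{N+1}[χ]| ≤ s·‖χ‖∞·(K₁/(N+1) + 2eSδ)`,  `K₁ = 4e²λS + 2eθ/(1−θ)²`,
  `S = θ/(1−θ)² + (1−θ)⁻¹`, `θ = 2eλ`  (`tpt_onePt_step_le`, `tpt_onePt_shift_le`):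

differentiate the size-form expansion `LGFS.onePt_eq_sum` in the level — Pascal's rule for the binomial
(`tpt_coefN_succ_sub`, cost `4C p e²(k+1)θᵏ` by the tree bound with `t(k+2)`, `tpt_abs_choose_mul_Wd_le`),
telescoping of the ratio products along `rN_succ` (`tpt_abs_rN_succ_sub_le`: `(j+1)2^{j+1}δ` against
coefficients `Ce(eλ)ʲ`), and a level-dependent bound for the top coefficient (`tpt_abs_coefN_le_level`,
`tpt_abs_top_term_le`: `O(C θ/(N+1))`).  File 2 (`…MesoTwoPtTruncated`) turns this into the quantitative
truncated two-point function.  For the uniform profile the one-point expectation does not depend on the level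
at all (`mesoVar_Md_uniform`, p148322); this is the inhomogeneous, quantitative version.

No definitions, no named facts; axioms standard.  References: E. Pulvirenti, D. Tsagkarogiannis, Comm. Math.
Phys. 316 (2012) §3–5; D. Ruelle, *Statistical Mechanics* (1969) §4.2; H. Spohn, *Large Scale Dynamics of
Interacting Particles* (1991) Part I §2.3.
-/

noncomputable section

namespace Summit.AtomisticToContinuum.HydrodynamicLimit.Theorems.MesoChebyshevWindow

open MeasureTheory Finset Filter Topology
open Literature.Probability.LatticeModels Literature.MathematicalPhysics.StatisticalMechanics
  Literature.MathematicalPhysics.KineticTheory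

variable {P : DensityProfile} {σ : ℝ}

/-! ## §0 Elementary series bounds -/

/-- `∑_{j<J} (j+1) θʲ ≤ S = θ/(1−θ)² + (1−θ)⁻¹` at small density. -/
theorem tpt_sum_succ_mul_pow_le (hs : SmallDensity P σ) (J : ℕ) :
    ∑ j ∈ range J, ((j : ℝ) + 1) * geomRatio P σ ^ j ≤
      geomRatio P σ / (1 - geomRatio P σ) ^ 2 + (1 - geomRatio P σ)⁻¹ :=
  sum_le_hasSum _ (fun j _ => by have := hs.geomRatio_nonneg; positivity) hs.hasSum_succ_mul_geomRatio_pow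

/-- `M θ^M ≤ θ/(1−θ)²` for every `M` (one term of `∑ n θⁿ = θ/(1−θ)²`). -/
theorem tpt_nat_mul_pow_le (hs : SmallDensity P σ) (M : ℕ) :
    (M : ℝ) * geomRatio P σ ^ M ≤ geomRatio P σ / (1 - geomRatio P σ) ^ 2 := by
  have hθ0 := hs.geomRatio_nonneg
  have h := hasSum_coe_mul_geometric_of_norm_lt_one (𝕜 := ℝ) (r := geomRatio P σ)
    (by rw [Real.norm_eq_abs, abs_of_nonneg hθ0]; exact hs.geomRatio_lt_one)
  exact le_hasSum h M fun j _ => by positivity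

/-- `0 ≤ S`. -/
theorem tpt_S_nonneg (hs : SmallDensity P σ) :
    0 ≤ geomRatio P σ / (1 - geomRatio P σ) ^ 2 + (1 - geomRatio P σ)⁻¹ := by
  have hθ0 := hs.geomRatio_nonneg
  have hθ1 := hs.geomRatio_lt_one
  have : 0 < 1 - geomRatio P σ := by linarith
  positivity

/-- `θ/(1−θ)² ≤ S`. -/
theorem tpt_div_sq_le_S (hs : SmallDensity P σ) :
    geomRatio P σ / (1 - geomRatio P σ) ^ 2 ≤
      geomRatio P σ / (1 - geomRatio P σ) ^ 2 + (1 - geomRatio P σ)⁻¹ := by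
  have hθ1 := hs.geomRatio_lt_one
  have : 0 < 1 - geomRatio P σ := by linarith
  linarith [inv_nonneg.2 this.le]

/-! ## §2 Shift-Lipschitz of the one-point expectation -/

/-- **Level-dependent coefficient bound**: `|C(m, j) W^g_N(j+1)| ≤ C e (e m p_{ε_N})ʲ` for `|g| ≤ C`,
`j ≤ N` (as `abs_coefN_le`, keeping the level `m` instead of bounding `m p_{ε_N} ≤ λ`). -/
theorem tpt_abs_coefN_le_level (hs : SmallDensity P σ) {g : T3 → ℝ} (hg : Measurable g) {C : ℝ}
    (hgC : ∀ y, |g y| ≤ C) {N m j : ℕ} (hj : j ≤ N) :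
    |coefN P σ N g m j| ≤
      C * (Real.exp 1 * (Real.exp 1 * ((m : ℝ) * pOv P (hsDiameter σ N))) ^ j) := by
  have hσ := hs.σ_pos.le
  have hσ2 := hs.σ_lt_half
  have hC : 0 ≤ C := (abs_nonneg _).trans (hgC 0)
  have hp : 0 ≤ pOv P (hsDiameter σ N) := pOv_nonneg P (hsDiameter_nonneg' hσ N)
  have hW := abs_Wd_le (P := P) (n := N + 1) (hsDiameter_nonneg' hσ N) (hsDiameter_lt_half hσ hσ2 N)
    hg hgC (k := j + 1) (by omega) (by omega)
  rw [Nat.add_sub_cancel] at hW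
  have hchoose : (m.choose j : ℝ) ≤ (m : ℝ) ^ j / j.factorial := Nat.choose_le_pow_div j m
  rw [coefN, abs_mul, Nat.abs_cast]
  calc (m.choose j : ℝ) * |Wd P (hsDiameter σ N) (N + 1) g (j + 1)|
      ≤ ((m : ℝ) ^ j / j.factorial) * (C * (treeNumber (j + 1) * pOv P (hsDiameter σ N) ^ j)) :=
        mul_le_mul hchoose hW (abs_nonneg _) (by positivity)
    _ = C * ((treeNumber (j + 1) : ℝ) * ((m : ℝ) * pOv P (hsDiameter σ N)) ^ j / j.factorial) := by
        rw [mul_pow]; ring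
    _ ≤ C * (Real.exp 1 * (Real.exp 1 * ((m : ℝ) * pOv P (hsDiameter σ N))) ^ j) :=
        mul_le_mul_of_nonneg_left (treeNumber_succ_mul_pow_div_factorial_le (by positivity) j) hC

/-- **Pascal's rule for the coefficients**: `C(m+1, k+1) W(k+2) − C(m, k+1) W(k+2) = C(m, k) W(k+2)`. -/
theorem tpt_coefN_succ_sub (N : ℕ) (g : T3 → ℝ) (m k : ℕ) :
    coefN P σ N g (m + 1) (k + 1) - coefN P σ N g m (k + 1) =
      (m.choose k : ℝ) * Wd P (hsDiameter σ N) (N + 1) g (k + 2) := by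
  simp only [coefN, Nat.choose_succ_succ', Nat.cast_add]
  ring

/-- **Bound on the binomial difference**: `|C(m, k) W^g_N(k+2)| ≤ C p_{ε_N} e² (k+1) (eλ)ᵏ` for `|g| ≤ C`,
`k + 1 ≤ N`, `m ≤ N + 1` (tree bound with `t(k+2)`, `C(m,k) ≤ mᵏ/k!`, `m p_{ε_N} ≤ λ`). -/
theorem tpt_abs_choose_mul_Wd_le (hs : SmallDensity P σ) {g : T3 → ℝ} (hg : Measurable g) {C : ℝ}
    (hgC : ∀ y, |g y| ≤ C) {N m k : ℕ} (hk : k + 1 ≤ N) (hm : m ≤ N + 1) :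
    |(m.choose k : ℝ) * Wd P (hsDiameter σ N) (N + 1) g (k + 2)| ≤
      C * pOv P (hsDiameter σ N) *
        (Real.exp 1 ^ 2 * ((k : ℝ) + 1) * (Real.exp 1 * ovDensity P σ) ^ k) := by
  have hσ := hs.σ_pos.le
  have hσ2 := hs.σ_lt_half
  have hC : 0 ≤ C := (abs_nonneg _).trans (hgC 0)
  have hp : 0 ≤ pOv P (hsDiameter σ N) := pOv_nonneg P (hsDiameter_nonneg' hσ N)
  have hW := abs_Wd_le (P := P) (n := N + 1) (hsDiameter_nonneg' hσ N) (hsDiameter_lt_half hσ hσ2 N)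
    hg hgC (k := k + 2) (by omega) (by omega)
  rw [show k + 2 - 1 = k + 1 by omega] at hW
  have hchoose : (m.choose k : ℝ) ≤ (m : ℝ) ^ k / k.factorial := Nat.choose_le_pow_div k m
  have hmp : (m : ℝ) * pOv P (hsDiameter σ N) ≤ ovDensity P σ := mul_pOv_le_ovDensity hσ hm
  have hmp0 : 0 ≤ (m : ℝ) * pOv P (hsDiameter σ N) := by positivity
  rw [abs_mul, Nat.abs_cast]
  calc (m.choose k : ℝ) * |Wd P (hsDiameter σ N) (N + 1) g (k + 2)|
      ≤ ((m : ℝ) ^ k / k.factorial) * (C * (treeNumber (k + 2) * pOv P (hsDiameter σ N) ^ (k + 1))) :=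
        mul_le_mul hchoose hW (abs_nonneg _) (by positivity)
    _ = C * pOv P (hsDiameter σ N) *
          ((treeNumber (k + 2) : ℝ) * ((m : ℝ) * pOv P (hsDiameter σ N)) ^ k / k.factorial) := by
        rw [mul_pow, pow_succ]; ring
    _ ≤ C * pOv P (hsDiameter σ N) *
          (Real.exp 1 ^ 2 * ((k : ℝ) + 1) * (Real.exp 1 * ((m : ℝ) * pOv P (hsDiameter σ N))) ^ k) :=
        mul_le_mul_of_nonneg_left (treeNumber_succ_succ_mul_pow_div_factorial_le hmp0 k) (by positivity)
    _ ≤ C * pOv P (hsDiameter σ N) *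
          (Real.exp 1 ^ 2 * ((k : ℝ) + 1) * (Real.exp 1 * ovDensity P σ) ^ k) := by
        gcongr

/-- **Telescoping of the ratio products**: if the insertion ratios are `δ`-Lipschitz in the level below `M`,
then `|r_N(M+1, j) − r_N(M, j)| ≤ j 2ʲ δ` for `j ≤ M ≤ N` (`rN_succ`, all ratios in `[1, 2]`). -/
theorem tpt_abs_rN_succ_sub_le (hs : SmallDensity P σ) {N M : ℕ} (hM : M ≤ N) {δ : ℝ} (hδ : 0 ≤ δ)
    (hq : ∀ k, k + 1 ≤ M → |qN P σ N (k + 1) - qN P σ N k| ≤ δ) :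
    ∀ j, j ≤ M → |rN P σ N (M + 1) j - rN P σ N M j| ≤ (j : ℝ) * 2 ^ j * δ := by
  have hσ := hs.σ_pos.le
  have hσ2 := hs.σ_lt_half
  have hlam1 := hs.ovDensity_lt_one
  intro j
  induction j with
  | zero =>
      intro _
      rw [rN_zero hσ hσ2 hlam1 (by omega), rN_zero hσ hσ2 hlam1 (by omega)]
      simp
  | succ j ih =>
      intro hj
      have hE := ih (by omega)
      rw [rN_succ hσ hσ2 hlam1 (m := M + 1) (by omega) (by omega),
        rN_succ hσ hσ2 hlam1 (m := M) (by omega) (by omega),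
        show M + 1 - 1 - j = M - j by omega]
      have hqd : |qN P σ N (M - j) - qN P σ N (M - 1 - j)| ≤ δ := by
        have h := hq (M - 1 - j) (by omega)
        rwa [show M - 1 - j + 1 = M - j by omega] at h
      have hq2 : |qN P σ N (M - j)| ≤ 2 := by
        rw [abs_of_nonneg (qN_pos hσ hσ2 hlam1 (by omega)).le]
        exact hs.qN_le_two (by omega)
      have hr2 : |rN P σ N M j| ≤ 2 ^ j := by
        rw [abs_of_nonneg (zero_le_one.trans (one_le_rN hσ hσ2 hlam1 (by omega) (by omega)))]
        exact hs.rN_le_two_pow (by omega) (by omega)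
      have hsplit : rN P σ N (M + 1) j * qN P σ N (M - j) - rN P σ N M j * qN P σ N (M - 1 - j) =
          (rN P σ N (M + 1) j - rN P σ N M j) * qN P σ N (M - j) +
            rN P σ N M j * (qN P σ N (M - j) - qN P σ N (M - 1 - j)) := by ring
      rw [hsplit]
      calc |(rN P σ N (M + 1) j - rN P σ N M j) * qN P σ N (M - j) +
            rN P σ N M j * (qN P σ N (M - j) - qN P σ N (M - 1 - j))|
          ≤ |rN P σ N (M + 1) j - rN P σ N M j| * |qN P σ N (M - j)| +
              |rN P σ N M j| * |qN P σ N (M - j) - qN P σ N (M - 1 - j)| := by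
            refine (abs_add_le _ _).trans (le_of_eq ?_)
            rw [abs_mul, abs_mul]
        _ ≤ ((j : ℝ) * 2 ^ j * δ) * 2 + 2 ^ j * δ :=
            add_le_add (mul_le_mul hE hq2 (abs_nonneg _) (by positivity))
              (mul_le_mul hr2 hqd (abs_nonneg _) (by positivity))
        _ ≤ ((j + 1 : ℕ) : ℝ) * 2 ^ (j + 1) * δ := by
            push_cast
            rw [pow_succ]
            nlinarith [pow_nonneg (zero_le_two : (0 : ℝ) ≤ 2) j]

/-- **The top coefficient is negligible**: `|C(M,M) W^χ(M+1) · r_N(M+1, M+1)| ≤ 2 C e θ/((1−θ)²(N+1))` for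
`1 ≤ M ≤ N` — level-dependent bound `C e (eMp)ᴹ 2^{M+1} = 2Ce θᴹ (M/(N+1))ᴹ ≤ 2Ce θᴹ M/(N+1)`. -/
theorem tpt_abs_top_term_le (hs : SmallDensity P σ) {χ : T3 → ℝ} (hχ : Measurable χ) {C : ℝ}
    (hχC : ∀ y, |χ y| ≤ C) {N M : ℕ} (hM1 : 1 ≤ M) (hM : M ≤ N) :
    |coefN P σ N χ M M * rN P σ N (M + 1) (M + 1)| ≤
      2 * C * Real.exp 1 * (geomRatio P σ / (1 - geomRatio P σ) ^ 2) / ((N : ℝ) + 1) := by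
  have hσ := hs.σ_pos.le
  have hσ2 := hs.σ_lt_half
  have hlam1 := hs.ovDensity_lt_one
  have hθ0 := hs.geomRatio_nonneg
  have hθ1 := hs.geomRatio_lt_one
  have hC : 0 ≤ C := (abs_nonneg _).trans (hχC 0)
  have hN0 : (0 : ℝ) < (N : ℝ) + 1 := by positivity
  have hco := tpt_abs_coefN_le_level hs hχ hχC (N := N) (m := M) (j := M) hM
  have hr0 : 0 ≤ rN P σ N (M + 1) (M + 1) :=
    zero_le_one.trans (one_le_rN hσ hσ2 hlam1 (by omega) (by omega))
  have hr2 : rN P σ N (M + 1) (M + 1) ≤ 2 ^ (M + 1) := hs.rN_le_two_pow (by omega) (by omega)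
  -- `e M p 2 = θ M/(N+1)`
  have hp : pOv P (hsDiameter σ N) = ovDensity P σ / ((N : ℝ) + 1) := by
    rw [pOv_hsDiameter]; push_cast; ring
  set t : ℝ := (M : ℝ) / ((N : ℝ) + 1) with ht
  have ht0 : 0 ≤ t := by positivity
  have ht1 : t ≤ 1 := by
    rw [ht, div_le_one hN0]
    exact_mod_cast (show M ≤ N + 1 by omega)
  have hkey : Real.exp 1 * (Real.exp 1 * ((M : ℝ) * pOv P (hsDiameter σ N))) ^ M * 2 ^ (M + 1) =
      2 * Real.exp 1 * (geomRatio P σ * t) ^ M := by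
    rw [hp, geomRatio, ht]
    ring
  -- `(θ t)^M ≤ θ^M t` and `M θ^M ≤ θ/(1-θ)²`
  have hpow : (geomRatio P σ * t) ^ M ≤ geomRatio P σ ^ M * t := by
    rw [mul_pow]
    exact mul_le_mul_of_nonneg_left (pow_le_of_le_one ht0 ht1 (by omega)) (pow_nonneg hθ0 _)
  have hMθ := tpt_nat_mul_pow_le hs M
  have hpM : 0 ≤ pOv P (hsDiameter σ N) := pOv_nonneg P (hsDiameter_nonneg' hσ N)
  rw [abs_mul, abs_of_nonneg hr0]
  calc |coefN P σ N χ M M| * rN P σ N (M + 1) (M + 1)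
      ≤ C * (Real.exp 1 * (Real.exp 1 * ((M : ℝ) * pOv P (hsDiameter σ N))) ^ M) * 2 ^ (M + 1) :=
        mul_le_mul hco hr2 hr0 (mul_nonneg hC (by positivity))
    _ = C * (2 * Real.exp 1 * (geomRatio P σ * t) ^ M) := by rw [← hkey]; ring
    _ ≤ C * (2 * Real.exp 1 * (geomRatio P σ ^ M * t)) := by gcongr
    _ = 2 * C * Real.exp 1 * ((M : ℝ) * geomRatio P σ ^ M) / ((N : ℝ) + 1) := by
        rw [ht]; field_simp
    _ ≤ 2 * C * Real.exp 1 * (geomRatio P σ / (1 - geomRatio P σ) ^ 2) / ((N : ℝ) + 1) := by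
        gcongr

/-- **One shift step.**  If the insertion ratios are `δ`-Lipschitz in the level (`|q_N(k+1) − q_N(k)| ≤ δ`,
`k + 1 ≤ N`), then for `s + 1 ≤ N` and `|χ| ≤ C`:
`|E_{N+1-s}[χ] − E_{N-s}[χ]| ≤ C·((4e²λS + 2eθ/(1−θ)²)/(N+1) + 2eSδ)`, `S = θ/(1−θ)² + (1−θ)⁻¹`.
Proof: subtract the size-form expansions (`onePt_eq_sum`) at the levels `M'+1 = N − s` and `M'`; the binomial
differences are `C(M',k) W(k+2)` (Pascal) and cost `4Cp e²(k+1)θᵏ`; the ratio products differ by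
`(j+1)2^{j+1}δ` (`tpt_abs_rN_succ_sub_le`) against coefficients `Ce(eλ)ʲ`; the top coefficient is
`O(θ/(N+1))` (`tpt_abs_top_term_le`). -/
theorem tpt_onePt_step_le (hs : SmallDensity P σ) {χ : T3 → ℝ} (hχ : Measurable χ) {C : ℝ}
    (hχC : ∀ y, |χ y| ≤ C) {N s : ℕ} (hsN : s + 1 ≤ N) {δ : ℝ} (hδ : 0 ≤ δ)
    (hq : ∀ k, k + 1 ≤ N → |qN P σ N (k + 1) - qN P σ N k| ≤ δ) :
    |onePt P σ χ N s - onePt P σ χ N (s + 1)| ≤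
      C * ((4 * Real.exp 1 ^ 2 * ovDensity P σ *
              (geomRatio P σ / (1 - geomRatio P σ) ^ 2 + (1 - geomRatio P σ)⁻¹) +
            2 * Real.exp 1 * (geomRatio P σ / (1 - geomRatio P σ) ^ 2)) / ((N : ℝ) + 1) +
          2 * Real.exp 1 * (geomRatio P σ / (1 - geomRatio P σ) ^ 2 + (1 - geomRatio P σ)⁻¹) * δ) := by
  have hσ := hs.σ_pos.le
  have hσ2 := hs.σ_lt_half
  have hlam1 := hs.ovDensity_lt_one
  have hl0 := hs.ovDensity_nonneg
  have hθ0 := hs.geomRatio_nonneg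
  have hC : 0 ≤ C := (abs_nonneg _).trans (hχC 0)
  have hN0 : (0 : ℝ) < (N : ℝ) + 1 := by positivity
  have hS0 := tpt_S_nonneg hs
  set θ := geomRatio P σ with hθ
  set S := geomRatio P σ / (1 - geomRatio P σ) ^ 2 + (1 - geomRatio P σ)⁻¹ with hS
  set p := pOv P (hsDiameter σ N) with hpdef
  have hp0 : 0 ≤ p := pOv_nonneg P (hsDiameter_nonneg' hσ N)
  have hp : p = ovDensity P σ / ((N : ℝ) + 1) := by
    rw [hpdef, pOv_hsDiameter]; push_cast; ring
  -- the level `M' + 1 = N - s ≥ 1`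
  obtain ⟨M', hM'⟩ : ∃ M', N - s = M' + 1 := ⟨N - s - 1, by omega⟩
  have hM'N : M' + 1 ≤ N := by omega
  -- the two expansions
  have h1 : onePt P σ χ N s =
      ∑ j ∈ range (M' + 2), coefN P σ N χ (M' + 1) j * rN P σ N (M' + 2) (j + 1) := by
    rw [LGFS.onePt_eq_sum hχ hχC (show s ≤ N by omega), show N + 1 - s = M' + 2 by omega, hM']
  have h2 : onePt P σ χ N (s + 1) =
      ∑ j ∈ range (M' + 1), coefN P σ N χ M' j * rN P σ N (M' + 1) (j + 1) := by
    rw [LGFS.onePt_eq_sum hχ hχC (show s + 1 ≤ N by omega), show N + 1 - (s + 1) = M' + 1 by omega,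
      show N - (s + 1) = M' by omega]
  -- the decomposition `A + B + top`
  set A : ℝ := ∑ k ∈ range M', ((M'.choose k : ℝ) * Wd P (hsDiameter σ N) (N + 1) χ (k + 2)) *
    rN P σ N (M' + 2) (k + 2) with hA
  set B : ℝ := ∑ j ∈ range (M' + 1), coefN P σ N χ M' j *
    (rN P σ N (M' + 2) (j + 1) - rN P σ N (M' + 1) (j + 1)) with hB
  set top : ℝ := coefN P σ N χ (M' + 1) (M' + 1) * rN P σ N (M' + 2) (M' + 2) with htop
  have hdec : onePt P σ χ N s - onePt P σ χ N (s + 1) = A + B + top := by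
    have hPascal : ∑ j ∈ range (M' + 1), (coefN P σ N χ (M' + 1) j - coefN P σ N χ M' j) *
        rN P σ N (M' + 2) (j + 1) = A := by
      rw [sum_range_succ', hA]
      have h0 : (coefN P σ N χ (M' + 1) 0 - coefN P σ N χ M' 0) * rN P σ N (M' + 2) (0 + 1) = 0 := by
        simp [coefN]
      rw [h0, add_zero]
      exact sum_congr rfl fun k _ => by rw [tpt_coefN_succ_sub]
    have hsum : ∑ j ∈ range (M' + 1), (coefN P σ N χ (M' + 1) j - coefN P σ N χ M' j) *
          rN P σ N (M' + 2) (j + 1) + B =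
        ∑ j ∈ range (M' + 1), coefN P σ N χ (M' + 1) j * rN P σ N (M' + 2) (j + 1) -
          ∑ j ∈ range (M' + 1), coefN P σ N χ M' j * rN P σ N (M' + 1) (j + 1) := by
      rw [hB, ← sum_add_distrib, ← sum_sub_distrib]
      exact sum_congr rfl fun j _ => by ring
    rw [h1, h2, sum_range_succ, show M' + 1 + 1 = M' + 2 from rfl, ← hPascal, htop]
    linarith [hsum]
  -- bound on `A`
  have hAle : |A| ≤ 4 * C * p * Real.exp 1 ^ 2 * S := by
    have hterm : ∀ k ∈ range M',
        |((M'.choose k : ℝ) * Wd P (hsDiameter σ N) (N + 1) χ (k + 2)) * rN P σ N (M' + 2) (k + 2)| ≤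
          4 * C * p * Real.exp 1 ^ 2 * (((k : ℝ) + 1) * θ ^ k) := by
      intro k hk
      have hk' := mem_range.mp hk
      have hco := tpt_abs_choose_mul_Wd_le hs hχ hχC (N := N) (m := M') (k := k) (by omega) (by omega)
      have hr0 : 0 ≤ rN P σ N (M' + 2) (k + 2) :=
        zero_le_one.trans (one_le_rN hσ hσ2 hlam1 (by omega) (by omega))
      have hr2 : rN P σ N (M' + 2) (k + 2) ≤ 2 ^ (k + 2) := hs.rN_le_two_pow (by omega) (by omega)
      rw [abs_mul, abs_of_nonneg hr0]
      calc |(M'.choose k : ℝ) * Wd P (hsDiameter σ N) (N + 1) χ (k + 2)| * rN P σ N (M' + 2) (k + 2)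
          ≤ (C * p * (Real.exp 1 ^ 2 * ((k : ℝ) + 1) * (Real.exp 1 * ovDensity P σ) ^ k)) * 2 ^ (k + 2) :=
            mul_le_mul hco hr2 hr0 (by positivity)
        _ = 4 * C * p * Real.exp 1 ^ 2 * (((k : ℝ) + 1) * θ ^ k) := by
            rw [hθ, geomRatio]; ring
    calc |A| ≤ ∑ k ∈ range M', |((M'.choose k : ℝ) * Wd P (hsDiameter σ N) (N + 1) χ (k + 2)) *
          rN P σ N (M' + 2) (k + 2)| := abs_sum_le_sum_abs _ _
      _ ≤ ∑ k ∈ range M', 4 * C * p * Real.exp 1 ^ 2 * (((k : ℝ) + 1) * θ ^ k) := sum_le_sum hterm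
      _ = 4 * C * p * Real.exp 1 ^ 2 * ∑ k ∈ range M', ((k : ℝ) + 1) * θ ^ k := by rw [mul_sum]
      _ ≤ 4 * C * p * Real.exp 1 ^ 2 * S :=
          mul_le_mul_of_nonneg_left (tpt_sum_succ_mul_pow_le hs M') (by positivity)
  -- bound on `B`
  have hBle : |B| ≤ 2 * C * Real.exp 1 * S * δ := by
    have hrdiff := tpt_abs_rN_succ_sub_le hs (N := N) (M := M' + 1) hM'N hδ
      (fun k hk => hq k (by omega))
    have hterm : ∀ j ∈ range (M' + 1),
        |coefN P σ N χ M' j * (rN P σ N (M' + 2) (j + 1) - rN P σ N (M' + 1) (j + 1))| ≤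
          2 * C * Real.exp 1 * δ * (((j : ℝ) + 1) * θ ^ j) := by
      intro j hj
      have hj' := mem_range.mp hj
      have hco := abs_coefN_le (P := P) hσ hσ2 hχ hχC (N := N) (m := M') (j := j) (by omega) (by omega)
      have hr := hrdiff (j + 1) (by omega)
      rw [abs_mul]
      calc |coefN P σ N χ M' j| * |rN P σ N (M' + 1 + 1) (j + 1) - rN P σ N (M' + 1) (j + 1)|
          ≤ (C * (Real.exp 1 * (Real.exp 1 * ovDensity P σ) ^ j)) * (((j + 1 : ℕ) : ℝ) * 2 ^ (j + 1) * δ) :=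
            mul_le_mul hco hr (abs_nonneg _) (by positivity)
        _ = 2 * C * Real.exp 1 * δ * (((j : ℝ) + 1) * θ ^ j) := by
            rw [hθ, geomRatio]; push_cast; ring
    calc |B| ≤ ∑ j ∈ range (M' + 1),
          |coefN P σ N χ M' j * (rN P σ N (M' + 2) (j + 1) - rN P σ N (M' + 1) (j + 1))| :=
          abs_sum_le_sum_abs _ _
      _ ≤ ∑ j ∈ range (M' + 1), 2 * C * Real.exp 1 * δ * (((j : ℝ) + 1) * θ ^ j) := sum_le_sum hterm
      _ = 2 * C * Real.exp 1 * δ * ∑ j ∈ range (M' + 1), ((j : ℝ) + 1) * θ ^ j := by rw [mul_sum]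
      _ ≤ 2 * C * Real.exp 1 * δ * S :=
          mul_le_mul_of_nonneg_left (tpt_sum_succ_mul_pow_le hs (M' + 1)) (by positivity)
      _ = 2 * C * Real.exp 1 * S * δ := by ring
  -- bound on `top`
  have htople : |top| ≤ 2 * C * Real.exp 1 * (θ / (1 - θ) ^ 2) / ((N : ℝ) + 1) :=
    tpt_abs_top_term_le hs hχ hχC (N := N) (M := M' + 1) (by omega) hM'N
  -- assembly
  rw [hdec]
  calc |A + B + top| ≤ |A| + |B| + |top| := abs_add_three _ _ _
    _ ≤ 4 * C * p * Real.exp 1 ^ 2 * S + 2 * C * Real.exp 1 * S * δ +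
          2 * C * Real.exp 1 * (θ / (1 - θ) ^ 2) / ((N : ℝ) + 1) := add_le_add_three hAle hBle htople
    _ = _ := by rw [hp]; ring

/-- **Shift-Lipschitz of the one-point expectation** (telescoping `tpt_onePt_step_le`): for `s ≤ N`,
`|E_{N+1-s}[χ] − E_{N+1}[χ]| ≤ s·C·(K₁/(N+1) + 2eSδ)`, `K₁ = 4e²λS + 2eθ/(1−θ)²`. -/
theorem tpt_onePt_shift_le (hs : SmallDensity P σ) {χ : T3 → ℝ} (hχ : Measurable χ) {C : ℝ}
    (hχC : ∀ y, |χ y| ≤ C) {N : ℕ} {δ : ℝ} (hδ : 0 ≤ δ)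
    (hq : ∀ k, k + 1 ≤ N → |qN P σ N (k + 1) - qN P σ N k| ≤ δ) :
    ∀ s, s ≤ N → |onePt P σ χ N s - onePt P σ χ N 0| ≤
      (s : ℝ) * (C * ((4 * Real.exp 1 ^ 2 * ovDensity P σ *
              (geomRatio P σ / (1 - geomRatio P σ) ^ 2 + (1 - geomRatio P σ)⁻¹) +
            2 * Real.exp 1 * (geomRatio P σ / (1 - geomRatio P σ) ^ 2)) / ((N : ℝ) + 1) +
          2 * Real.exp 1 * (geomRatio P σ / (1 - geomRatio P σ) ^ 2 + (1 - geomRatio P σ)⁻¹) * δ)) := by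
  intro s
  induction s with
  | zero => intro _; simp
  | succ s ih =>
      intro hs1
      have hstep := tpt_onePt_step_le hs hχ hχC (N := N) (s := s) hs1 hδ hq
      have hprev := ih (by omega)
      calc |onePt P σ χ N (s + 1) - onePt P σ χ N 0|
          ≤ |onePt P σ χ N s - onePt P σ χ N (s + 1)| + |onePt P σ χ N s - onePt P σ χ N 0| := by
            rw [abs_sub_comm (onePt P σ χ N s) (onePt P σ χ N (s + 1))]
            exact abs_sub_le _ _ _
        _ ≤ _ := add_le_add hstep hprev
        _ = _ := by push_cast; ring

/-- **Shift-Lipschitz of the canonical one-point expectation, closed form** (registered helper statement of the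
line `meso-chebyshev-window`; = `tpt_onePt_shift_le`): at small density, given a level-Lipschitz bound `δ` for the
insertion ratios, `|E_{N+1-s}[χ] − E_{N+1}[χ]| ≤ s·C·(K₁/(N+1) + 2eSδ)` for `|χ| ≤ C`, `s ≤ N`. -/
theorem onePtShiftLipschitz : ∀ (P : DensityProfile) (σ : ℝ), SmallDensity P σ → ∀ (χ : T3 → ℝ) (C : ℝ), Measurable χ → (∀ y, |χ y| ≤ C) → ∀ (N : ℕ) (δ : ℝ), 0 ≤ δ → (∀ k, k + 1 ≤ N → |qN P σ N (k + 1) - qN P σ N k| ≤ δ) → ∀ s, s ≤ N → |onePt P σ χ N s - onePt P σ χ N 0| ≤ (s : ℝ) * (C * ((4 * Real.exp 1 ^ 2 * ovDensity P σ * (geomRatio P σ / (1 - geomRatio P σ) ^ 2 + (1 - geomRatio P σ)⁻¹) + 2 * Real.exp 1 * (geomRatio P σ / (1 - geomRatio P σ) ^ 2)) / ((N : ℝ) + 1) + 2 * Real.exp 1 * (geomRatio P σ / (1 - geomRatio P σ) ^ 2 + (1 - geomRatio P σ)⁻¹) * δ)) :=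
  fun _ _ hs _ _ hχ hχC _ _ hδ hq => tpt_onePt_shift_le hs hχ hχC hδ hq

end Summit.AtomisticToContinuum.HydrodynamicLimit.Theorems.MesoChebyshevWindow

end
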